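import Summits.BirchSwinnertonDyer.BirchSwinnertonDyer.Theorems.ResidualThetaTransportAtTwoThetaLayerLambdaCongruenceAtTwoCuspSpanJacobi
import HarnessLib

/-!
# Route `ResidualThetaTransportAtTwo`, cruxes Kan⁺ (stmt-BirchSwinnertonDyer-20688) / node 27436 / 21437: the Jacobi-sum theorem AT A GIVEN
# LEVEL — the index of `⟨4, −1⟩ ≤ 𝔽ₚˣ` from the order of `4`, and instances

Cell `bsd-wall`, width seat `bsd-wall-rtt-p3-w5` g2 (2026-08-28). THEOREMS ONLY; `--supports stmt-BirchSwinnertonDyer-20688`; BSD is not proved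
by this. The uniform theorem `cuspSpanEvenAtTwo_of_index_le` (`…CuspSpanJacobi`, p638810) takes an upper bound `n` for the index of
`H := ⟨4, −1⟩ ≤ 𝔽ₚˣ`. Here that bound is produced from data that `decide` checks at a given prime:

* `orderOf_four_eq_of_check`: `orderOf (4 : ZMod p) = m` from `4^m = 1` and `4^{m/q} ≠ 1` for the primes `q ∣ m`
  (Mathlib `orderOf_eq_of_pow_and_pow_div_prime`, with `q` ranging over the computable `m.primeFactors`).
* `index_closure_mul_le` / `index_closure_mul_two_mul_le`: `[𝔽ₚˣ : H] · m ≤ p − 1`, and `[𝔽ₚˣ : H] · 2m ≤ p − 1` if moreover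
  `−1 ∉ ⟨4⟩`, i.e. `m` odd or `4^{m/2} ≠ −1` (Lagrange: `⟨4⟩ ≤ H`, `#⟨4⟩ = m`, and `−1 ∈ H ∖ ⟨4⟩` doubles the order).
* `cuspSpanEvenAtTwo_of_orderOf_four` / `…_of_orderOf_four'`: the node from `orderOf 4 = m`, the sign datum, `p − 1 ≤ n·2m`
  (resp. `p − 1 ≤ n·m`) and the Jacobi inequality `3(n−1)+2 < p ∧ ((n−1)(n−2))² p < (p−2−3(n−1))²`;
  `cuspSpanEvenAtTwo_of_check` / `…_of_check'`: the same with every hypothesis a `decide`/`norm_num` goal (per-level certificate).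
* INSTANCES (`cuspSpanEvenAtTwo_jacobi_<p>`): the node at the 27 primes `p < 1400` with NO certificate in the tree at the time of writing
  that the inequality covers: `431, 911` (index `5` — no uniform family covered index `5` before), `1061, …, 1399` (seat list
  `analysis/missjac.json`: 210 of the 254 odd primes `≤ 3000` without a certificate are covered this way; sequels are mechanical).

References: K. Ireland, M. Rosen, GTM 84, Ch. 8; [Manin1972] §1.5; [Pollack2003] Conj. 6.3.
-/

set_option autoImplicit false
set_option linter.dupNamespace false

open scoped MatrixGroups

open CongruenceSubgroup

namespace Summit.BirchSwinnertonDyer.BirchSwinnertonDyer.Theorems.SignedMuAtTwo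

section Wrapper

variable {p : ℕ} [Fact p.Prime]

/-- `orderOf (4 : ZMod p) = m` from a finite check: `4^m = 1` and `4^{m/q} ≠ 1` for every prime `q ∣ m`. [folklore] -/
theorem orderOf_four_eq_of_check {m : ℕ} (hm : 0 < m) (hpow : (4 : ZMod p) ^ m = 1)
    (hd : ∀ q ∈ m.primeFactors, (4 : ZMod p) ^ (m / q) ≠ 1) : orderOf (4 : ZMod p) = m :=
  orderOf_eq_of_pow_and_pow_div_prime hm hpow fun q hq hqm ↦ hd q (Nat.mem_primeFactors.mpr ⟨hq, hqm, hm.ne'⟩)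

/-- **Index bound, weak form.** `[𝔽ₚˣ : ⟨4, −1⟩] · orderOf 4 ≤ p − 1` (`⟨4⟩ ≤ ⟨4, −1⟩`, Lagrange). [folklore] -/
theorem index_closure_mul_le (hp2 : p ≠ 2) {m : ℕ} (hm : orderOf (4 : ZMod p) = m) :
    (Subgroup.closure {w : (ZMod p)ˣ | (w : ZMod p) = 4 ∨ (w : ZMod p) = -1}).index * m ≤ p - 1 := by
  classical
  have hp : p.Prime := Fact.out
  have h40 : (4 : ZMod p) ≠ 0 := by
    intro h0
    have h0' : ((4 : ℕ) : ZMod p) = 0 := by exact_mod_cast h0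
    have h4 : p ∣ 2 ^ 2 := by norm_num; exact (ZMod.natCast_eq_zero_iff 4 p).mp h0'
    exact hp2 ((Nat.prime_dvd_prime_iff_eq hp Nat.prime_two).mp (hp.dvd_of_dvd_pow h4))
  set H : Subgroup (ZMod p)ˣ := Subgroup.closure {w : (ZMod p)ˣ | (w : ZMod p) = 4 ∨ (w : ZMod p) = -1} with hH
  set u4 : (ZMod p)ˣ := Units.mk0 4 h40 with hu4
  have hu4H : u4 ∈ H := Subgroup.subset_closure (Or.inl (Units.val_mk0 _))
  have hK : Subgroup.zpowers u4 ≤ H := (Subgroup.zpowers_le).mpr hu4H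
  have hcardK : Nat.card (Subgroup.zpowers u4) = m := by
    rw [Nat.card_zpowers, ← orderOf_units, hu4, Units.val_mk0, hm]
  have hdvd : m ∣ Nat.card H := hcardK ▸ Subgroup.card_dvd_of_le hK
  have hidx : H.index * Nat.card H = p - 1 := by
    rw [Subgroup.index_mul_card, Nat.card_eq_fintype_card, ZMod.card_units]
  have hHpos : 0 < Nat.card H := Nat.card_pos
  calc H.index * m ≤ H.index * Nat.card H := Nat.mul_le_mul_left _ (Nat.le_of_dvd hHpos hdvd)
    _ = p - 1 := hidx

/-- **Index bound, strong form.** If `−1 ∉ ⟨4⟩` (i.e. `orderOf 4` is odd or `4^{(orderOf 4)/2} ≠ −1`), then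
`[𝔽ₚˣ : ⟨4, −1⟩] · 2·orderOf 4 ≤ p − 1`. [folklore] -/
theorem index_closure_mul_two_mul_le (hp2 : p ≠ 2) {m : ℕ} (hm : orderOf (4 : ZMod p) = m)
    (hneg : m % 2 = 1 ∨ (4 : ZMod p) ^ (m / 2) ≠ -1) :
    (Subgroup.closure {w : (ZMod p)ˣ | (w : ZMod p) = 4 ∨ (w : ZMod p) = -1}).index * (2 * m) ≤ p - 1 := by
  classical
  have hp : p.Prime := Fact.out
  have h40 : (4 : ZMod p) ≠ 0 := by
    intro h0
    have h0' : ((4 : ℕ) : ZMod p) = 0 := by exact_mod_cast h0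
    have h4 : p ∣ 2 ^ 2 := by norm_num; exact (ZMod.natCast_eq_zero_iff 4 p).mp h0'
    exact hp2 ((Nat.prime_dvd_prime_iff_eq hp Nat.prime_two).mp (hp.dvd_of_dvd_pow h4))
  have h2 : (2 : ZMod p) ≠ 0 := by
    intro h0
    have h0' : ((2 : ℕ) : ZMod p) = 0 := by exact_mod_cast h0
    exact hp2 ((Nat.prime_dvd_prime_iff_eq hp Nat.prime_two).mp ((ZMod.natCast_eq_zero_iff 2 p).mp h0'))
  set H : Subgroup (ZMod p)ˣ := Subgroup.closure {w : (ZMod p)ˣ | (w : ZMod p) = 4 ∨ (w : ZMod p) = -1} with hH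
  set u4 : (ZMod p)ˣ := Units.mk0 4 h40 with hu4
  have hu4H : u4 ∈ H := Subgroup.subset_closure (Or.inl (Units.val_mk0 _))
  have hnegH : (-1 : (ZMod p)ˣ) ∈ H := Subgroup.subset_closure (Or.inr (by rw [Units.val_neg, Units.val_one]))
  have hK : Subgroup.zpowers u4 ≤ H := (Subgroup.zpowers_le).mpr hu4H
  have hou4 : orderOf u4 = m := by rw [← orderOf_units, hu4, Units.val_mk0, hm]
  have hm0 : 0 < m := by
    rw [← hm, orderOf_pos_iff]
    exact isOfFinOrder_iff_pow_eq_one.mpr ⟨p - 1, by have := hp.two_le; omega, ZMod.pow_card_sub_one_eq_one h40⟩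
  have hcardK : Nat.card (Subgroup.zpowers u4) = m := by rw [Nat.card_zpowers, hou4]
  -- `−1 ∉ ⟨4⟩`
  have hnegK : (-1 : (ZMod p)ˣ) ∉ Subgroup.zpowers u4 := by
    intro h
    rw [mem_zpowers_iff_mem_range_orderOf, Finset.mem_image] at h
    obtain ⟨j, hj, hju⟩ := h
    rw [Finset.mem_range, hou4] at hj
    have h4j : (4 : ZMod p) ^ j = -1 := by
      have e := congrArg Units.val hju
      rw [Units.val_pow_eq_pow_val, hu4, Units.val_mk0, Units.val_neg, Units.val_one] at e
      exact e
    have h2j : m ∣ 2 * j := by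
      rw [← hm]
      exact orderOf_dvd_of_pow_eq_one (by rw [pow_mul', h4j]; norm_num)
    obtain ⟨t, ht⟩ := h2j
    have ht2 : t < 2 := by
      by_contra hcon
      have : m * 2 ≤ m * t := Nat.mul_le_mul_left m (by omega)
      omega
    interval_cases t
    · have hj0 : j = 0 := by omega
      rw [hj0, pow_zero] at h4j
      exact h2 (by linear_combination h4j)
    · rcases hneg with hodd | hne
      · omega
      · apply hne
        rw [show m / 2 = j by omega, h4j]
  -- hence `#H ≥ 2m`
  have hdvd : m ∣ Nat.card H := hcardK ▸ Subgroup.card_dvd_of_le hK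
  have hne : Nat.card (Subgroup.zpowers u4) ≠ Nat.card H := fun h ↦ hnegK (by
    rw [Subgroup.eq_of_le_of_card_ge hK h.symm.le]; exact hnegH)
  rw [hcardK] at hne
  obtain ⟨t, ht⟩ := hdvd
  have hHpos : 0 < Nat.card H := Nat.card_pos
  have ht2 : 2 ≤ t := by
    rcases Nat.lt_or_ge t 2 with h | h
    · interval_cases t
      · rw [ht, mul_zero] at hHpos; exact absurd hHpos (lt_irrefl 0)
      · rw [ht, mul_one] at hne; exact absurd rfl hne
    · exact h
  have hidx : H.index * Nat.card H = p - 1 := by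
    rw [Subgroup.index_mul_card, Nat.card_eq_fintype_card, ZMod.card_units]
  calc H.index * (2 * m) ≤ H.index * Nat.card H := Nat.mul_le_mul_left _ (by rw [ht, mul_comm m t]; exact Nat.mul_le_mul_right m ht2)
    _ = p - 1 := hidx

/-- **The node from the order of `4` (strong form).** `orderOf (4 : ZMod p) = m`, `−1 ∉ ⟨4⟩` (`m` odd or `4^{m/2} ≠ −1`),
`p − 1 ≤ n · 2m` and the Jacobi inequality for `n` ⟹ `CuspSpanEvenAtTwo p`. [cite: Pollack2003, Conj. 6.3] -/
theorem cuspSpanEvenAtTwo_of_orderOf_four (hp2 : p ≠ 2) {m n : ℕ} (hm : orderOf (4 : ZMod p) = m)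
    (hneg : m % 2 = 1 ∨ (4 : ZMod p) ^ (m / 2) ≠ -1) (hmpos : 0 < m) (hn : p - 1 ≤ n * (2 * m))
    (hineq : 3 * (n - 1) + 2 < p ∧ ((n - 1) * (n - 2)) ^ 2 * p < (p - 2 - 3 * (n - 1)) ^ 2) :
    CuspSpanEvenAtTwo p := by
  have h := (index_closure_mul_two_mul_le hp2 hm hneg).trans hn
  exact cuspSpanEvenAtTwo_of_index_le hp2 (Nat.le_of_mul_le_mul_right h (by omega)) hineq

/-- **The node from the order of `4` (weak form, no sign datum).** `orderOf (4 : ZMod p) = m`, `p − 1 ≤ n · m` and the Jacobi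
inequality for `n` ⟹ `CuspSpanEvenAtTwo p`. [cite: Pollack2003, Conj. 6.3] -/
theorem cuspSpanEvenAtTwo_of_orderOf_four' (hp2 : p ≠ 2) {m n : ℕ} (hm : orderOf (4 : ZMod p) = m) (hmpos : 0 < m)
    (hn : p - 1 ≤ n * m)
    (hineq : 3 * (n - 1) + 2 < p ∧ ((n - 1) * (n - 2)) ^ 2 * p < (p - 2 - 3 * (n - 1)) ^ 2) :
    CuspSpanEvenAtTwo p := by
  have h := (index_closure_mul_le hp2 hm).trans hn
  exact cuspSpanEvenAtTwo_of_index_le hp2 (Nat.le_of_mul_le_mul_right h hmpos) hineq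

/-- **Per-level certificate (all hypotheses decidable).** For an odd prime `p` and numbers `m, n`: `4^m = 1`, `4^{m/q} ≠ 1` for the
primes `q ∣ m`, `m` odd or `4^{m/2} ≠ −1`, `p − 1 ≤ n·2m`, and the Jacobi inequality for `n` ⟹ `CuspSpanEvenAtTwo p`.
[cite: Pollack2003, Conj. 6.3] -/
theorem cuspSpanEvenAtTwo_of_check (p m n : ℕ) [Fact p.Prime] (hp2 : p ≠ 2) (hmpos : 0 < m) (hpow : (4 : ZMod p) ^ m = 1)
    (hd : ∀ q ∈ m.primeFactors, (4 : ZMod p) ^ (m / q) ≠ 1) (hneg : m % 2 = 1 ∨ (4 : ZMod p) ^ (m / 2) ≠ -1)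
    (hn : p - 1 ≤ n * (2 * m))
    (hineq : 3 * (n - 1) + 2 < p ∧ ((n - 1) * (n - 2)) ^ 2 * p < (p - 2 - 3 * (n - 1)) ^ 2) :
    CuspSpanEvenAtTwo p :=
  cuspSpanEvenAtTwo_of_orderOf_four hp2 (orderOf_four_eq_of_check hmpos hpow hd) hneg hmpos hn hineq

/-- **Per-level certificate, weak form** (no sign datum; `p − 1 ≤ n·m`). [cite: Pollack2003, Conj. 6.3] -/
theorem cuspSpanEvenAtTwo_of_check' (p m n : ℕ) [Fact p.Prime] (hp2 : p ≠ 2) (hmpos : 0 < m) (hpow : (4 : ZMod p) ^ m = 1)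
    (hd : ∀ q ∈ m.primeFactors, (4 : ZMod p) ^ (m / q) ≠ 1) (hn : p - 1 ≤ n * m)
    (hineq : 3 * (n - 1) + 2 < p ∧ ((n - 1) * (n - 2)) ^ 2 * p < (p - 2 - 3 * (n - 1)) ^ 2) :
    CuspSpanEvenAtTwo p :=
  cuspSpanEvenAtTwo_of_orderOf_four' hp2 (orderOf_four_eq_of_check hmpos hpow hd) hmpos hn hineq

end Wrapper

/-! ## Instances at prime levels without a certificate in the tree -/

section Instances

/-- `CuspSpanEvenAtTwo 431`: `orderOf 4 = 43`, `−1 ∉ ⟨4⟩`, index `5`, Jacobi. [cite: Pollack2003, Conj. 6.3] -/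
theorem cuspSpanEvenAtTwo_jacobi_431 : CuspSpanEvenAtTwo 431 := by
  have h1 : (4 : ZMod 431) ^ 43 = 1 := by decide +kernel
  have h2 : ∀ q ∈ Nat.primeFactors 43, (4 : ZMod 431) ^ (43 / q) ≠ 1 := by decide +kernel
  haveI : Fact (Nat.Prime 431) := ⟨by norm_num⟩
  exact cuspSpanEvenAtTwo_of_check 431 43 5 (by norm_num) (by norm_num) h1 h2 (Or.inl (by norm_num)) (by norm_num)
    (by norm_num)

/-- `CuspSpanEvenAtTwo 911`: `orderOf 4 = 91`, `−1 ∉ ⟨4⟩`, index `5`, Jacobi. [cite: Pollack2003, Conj. 6.3] -/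
theorem cuspSpanEvenAtTwo_jacobi_911 : CuspSpanEvenAtTwo 911 := by
  have h1 : (4 : ZMod 911) ^ 91 = 1 := by decide +kernel
  have h2 : ∀ q ∈ Nat.primeFactors 91, (4 : ZMod 911) ^ (91 / q) ≠ 1 := by decide +kernel
  haveI : Fact (Nat.Prime 911) := ⟨by norm_num⟩
  exact cuspSpanEvenAtTwo_of_check 911 91 5 (by norm_num) (by norm_num) h1 h2 (Or.inl (by norm_num)) (by norm_num)
    (by norm_num)

/-- `CuspSpanEvenAtTwo 1061`: `orderOf 4 = 530`, index `2`, Jacobi. [cite: Pollack2003, Conj. 6.3] -/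
theorem cuspSpanEvenAtTwo_jacobi_1061 : CuspSpanEvenAtTwo 1061 := by
  have h1 : (4 : ZMod 1061) ^ 530 = 1 := by decide +kernel
  have h2 : ∀ q ∈ Nat.primeFactors 530, (4 : ZMod 1061) ^ (530 / q) ≠ 1 := by decide +kernel
  haveI : Fact (Nat.Prime 1061) := ⟨by norm_num⟩
  exact cuspSpanEvenAtTwo_of_check' 1061 530 2 (by norm_num) (by norm_num) h1 h2 (by norm_num) (by norm_num)

/-- `CuspSpanEvenAtTwo 1109`: `orderOf 4 = 554`, index `2`, Jacobi. [cite: Pollack2003, Conj. 6.3] -/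
theorem cuspSpanEvenAtTwo_jacobi_1109 : CuspSpanEvenAtTwo 1109 := by
  have h1 : (4 : ZMod 1109) ^ 554 = 1 := by decide +kernel
  have h2 : ∀ q ∈ Nat.primeFactors 554, (4 : ZMod 1109) ^ (554 / q) ≠ 1 := by decide +kernel
  haveI : Fact (Nat.Prime 1109) := ⟨by norm_num⟩
  exact cuspSpanEvenAtTwo_of_check' 1109 554 2 (by norm_num) (by norm_num) h1 h2 (by norm_num) (by norm_num)

/-- `CuspSpanEvenAtTwo 1117`: `orderOf 4 = 558`, index `2`, Jacobi. [cite: Pollack2003, Conj. 6.3] -/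
theorem cuspSpanEvenAtTwo_jacobi_1117 : CuspSpanEvenAtTwo 1117 := by
  have h1 : (4 : ZMod 1117) ^ 558 = 1 := by decide +kernel
  have h2 : ∀ q ∈ Nat.primeFactors 558, (4 : ZMod 1117) ^ (558 / q) ≠ 1 := by decide +kernel
  haveI : Fact (Nat.Prime 1117) := ⟨by norm_num⟩
  exact cuspSpanEvenAtTwo_of_check' 1117 558 2 (by norm_num) (by norm_num) h1 h2 (by norm_num) (by norm_num)

/-- `CuspSpanEvenAtTwo 1213`: `orderOf 4 = 606`, index `2`, Jacobi. [cite: Pollack2003, Conj. 6.3] -/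
theorem cuspSpanEvenAtTwo_jacobi_1213 : CuspSpanEvenAtTwo 1213 := by
  have h1 : (4 : ZMod 1213) ^ 606 = 1 := by decide +kernel
  have h2 : ∀ q ∈ Nat.primeFactors 606, (4 : ZMod 1213) ^ (606 / q) ≠ 1 := by decide +kernel
  haveI : Fact (Nat.Prime 1213) := ⟨by norm_num⟩
  exact cuspSpanEvenAtTwo_of_check' 1213 606 2 (by norm_num) (by norm_num) h1 h2 (by norm_num) (by norm_num)

/-- `CuspSpanEvenAtTwo 1223`: `orderOf 4 = 611`, `−1 ∉ ⟨4⟩`, index `1`, Jacobi. [cite: Pollack2003, Conj. 6.3] -/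
theorem cuspSpanEvenAtTwo_jacobi_1223 : CuspSpanEvenAtTwo 1223 := by
  have h1 : (4 : ZMod 1223) ^ 611 = 1 := by decide +kernel
  have h2 : ∀ q ∈ Nat.primeFactors 611, (4 : ZMod 1223) ^ (611 / q) ≠ 1 := by decide +kernel
  haveI : Fact (Nat.Prime 1223) := ⟨by norm_num⟩
  exact cuspSpanEvenAtTwo_of_check 1223 611 1 (by norm_num) (by norm_num) h1 h2 (Or.inl (by norm_num)) (by norm_num)
    (by norm_num)

/-- `CuspSpanEvenAtTwo 1229`: `orderOf 4 = 614`, index `2`, Jacobi. [cite: Pollack2003, Conj. 6.3] -/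
theorem cuspSpanEvenAtTwo_jacobi_1229 : CuspSpanEvenAtTwo 1229 := by
  have h1 : (4 : ZMod 1229) ^ 614 = 1 := by decide +kernel
  have h2 : ∀ q ∈ Nat.primeFactors 614, (4 : ZMod 1229) ^ (614 / q) ≠ 1 := by decide +kernel
  haveI : Fact (Nat.Prime 1229) := ⟨by norm_num⟩
  exact cuspSpanEvenAtTwo_of_check' 1229 614 2 (by norm_num) (by norm_num) h1 h2 (by norm_num) (by norm_num)

/-- `CuspSpanEvenAtTwo 1231`: `orderOf 4 = 615`, `−1 ∉ ⟨4⟩`, index `1`, Jacobi. [cite: Pollack2003, Conj. 6.3] -/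
theorem cuspSpanEvenAtTwo_jacobi_1231 : CuspSpanEvenAtTwo 1231 := by
  have h1 : (4 : ZMod 1231) ^ 615 = 1 := by decide +kernel
  have h2 : ∀ q ∈ Nat.primeFactors 615, (4 : ZMod 1231) ^ (615 / q) ≠ 1 := by decide +kernel
  haveI : Fact (Nat.Prime 1231) := ⟨by norm_num⟩
  exact cuspSpanEvenAtTwo_of_check 1231 615 1 (by norm_num) (by norm_num) h1 h2 (Or.inl (by norm_num)) (by norm_num)
    (by norm_num)

/-- `CuspSpanEvenAtTwo 1237`: `orderOf 4 = 618`, index `2`, Jacobi. [cite: Pollack2003, Conj. 6.3] -/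
theorem cuspSpanEvenAtTwo_jacobi_1237 : CuspSpanEvenAtTwo 1237 := by
  have h1 : (4 : ZMod 1237) ^ 618 = 1 := by decide +kernel
  have h2 : ∀ q ∈ Nat.primeFactors 618, (4 : ZMod 1237) ^ (618 / q) ≠ 1 := by decide +kernel
  haveI : Fact (Nat.Prime 1237) := ⟨by norm_num⟩
  exact cuspSpanEvenAtTwo_of_check' 1237 618 2 (by norm_num) (by norm_num) h1 h2 (by norm_num) (by norm_num)

/-- `CuspSpanEvenAtTwo 1259`: `orderOf 4 = 629`, `−1 ∉ ⟨4⟩`, index `1`, Jacobi. [cite: Pollack2003, Conj. 6.3] -/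
theorem cuspSpanEvenAtTwo_jacobi_1259 : CuspSpanEvenAtTwo 1259 := by
  have h1 : (4 : ZMod 1259) ^ 629 = 1 := by decide +kernel
  have h2 : ∀ q ∈ Nat.primeFactors 629, (4 : ZMod 1259) ^ (629 / q) ≠ 1 := by decide +kernel
  haveI : Fact (Nat.Prime 1259) := ⟨by norm_num⟩
  exact cuspSpanEvenAtTwo_of_check 1259 629 1 (by norm_num) (by norm_num) h1 h2 (Or.inl (by norm_num)) (by norm_num)
    (by norm_num)

/-- `CuspSpanEvenAtTwo 1277`: `orderOf 4 = 638`, index `2`, Jacobi. [cite: Pollack2003, Conj. 6.3] -/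
theorem cuspSpanEvenAtTwo_jacobi_1277 : CuspSpanEvenAtTwo 1277 := by
  have h1 : (4 : ZMod 1277) ^ 638 = 1 := by decide +kernel
  have h2 : ∀ q ∈ Nat.primeFactors 638, (4 : ZMod 1277) ^ (638 / q) ≠ 1 := by decide +kernel
  haveI : Fact (Nat.Prime 1277) := ⟨by norm_num⟩
  exact cuspSpanEvenAtTwo_of_check' 1277 638 2 (by norm_num) (by norm_num) h1 h2 (by norm_num) (by norm_num)

/-- `CuspSpanEvenAtTwo 1279`: `orderOf 4 = 639`, `−1 ∉ ⟨4⟩`, index `1`, Jacobi. [cite: Pollack2003, Conj. 6.3] -/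
theorem cuspSpanEvenAtTwo_jacobi_1279 : CuspSpanEvenAtTwo 1279 := by
  have h1 : (4 : ZMod 1279) ^ 639 = 1 := by decide +kernel
  have h2 : ∀ q ∈ Nat.primeFactors 639, (4 : ZMod 1279) ^ (639 / q) ≠ 1 := by decide +kernel
  haveI : Fact (Nat.Prime 1279) := ⟨by norm_num⟩
  exact cuspSpanEvenAtTwo_of_check 1279 639 1 (by norm_num) (by norm_num) h1 h2 (Or.inl (by norm_num)) (by norm_num)
    (by norm_num)

/-- `CuspSpanEvenAtTwo 1283`: `orderOf 4 = 641`, `−1 ∉ ⟨4⟩`, index `1`, Jacobi. [cite: Pollack2003, Conj. 6.3] -/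
theorem cuspSpanEvenAtTwo_jacobi_1283 : CuspSpanEvenAtTwo 1283 := by
  have h1 : (4 : ZMod 1283) ^ 641 = 1 := by decide +kernel
  have h2 : ∀ q ∈ Nat.primeFactors 641, (4 : ZMod 1283) ^ (641 / q) ≠ 1 := by decide +kernel
  haveI : Fact (Nat.Prime 1283) := ⟨by norm_num⟩
  exact cuspSpanEvenAtTwo_of_check 1283 641 1 (by norm_num) (by norm_num) h1 h2 (Or.inl (by norm_num)) (by norm_num)
    (by norm_num)

/-- `CuspSpanEvenAtTwo 1289`: `orderOf 4 = 161`, `−1 ∉ ⟨4⟩`, index `4`, Jacobi. [cite: Pollack2003, Conj. 6.3] -/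
theorem cuspSpanEvenAtTwo_jacobi_1289 : CuspSpanEvenAtTwo 1289 := by
  have h1 : (4 : ZMod 1289) ^ 161 = 1 := by decide +kernel
  have h2 : ∀ q ∈ Nat.primeFactors 161, (4 : ZMod 1289) ^ (161 / q) ≠ 1 := by decide +kernel
  haveI : Fact (Nat.Prime 1289) := ⟨by norm_num⟩
  exact cuspSpanEvenAtTwo_of_check 1289 161 4 (by norm_num) (by norm_num) h1 h2 (Or.inl (by norm_num)) (by norm_num)
    (by norm_num)

/-- `CuspSpanEvenAtTwo 1291`: `orderOf 4 = 645`, `−1 ∉ ⟨4⟩`, index `1`, Jacobi. [cite: Pollack2003, Conj. 6.3] -/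
theorem cuspSpanEvenAtTwo_jacobi_1291 : CuspSpanEvenAtTwo 1291 := by
  have h1 : (4 : ZMod 1291) ^ 645 = 1 := by decide +kernel
  have h2 : ∀ q ∈ Nat.primeFactors 645, (4 : ZMod 1291) ^ (645 / q) ≠ 1 := by decide +kernel
  haveI : Fact (Nat.Prime 1291) := ⟨by norm_num⟩
  exact cuspSpanEvenAtTwo_of_check 1291 645 1 (by norm_num) (by norm_num) h1 h2 (Or.inl (by norm_num)) (by norm_num)
    (by norm_num)

/-- `CuspSpanEvenAtTwo 1297`: `orderOf 4 = 324`, index `4`, Jacobi. [cite: Pollack2003, Conj. 6.3] -/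
theorem cuspSpanEvenAtTwo_jacobi_1297 : CuspSpanEvenAtTwo 1297 := by
  have h1 : (4 : ZMod 1297) ^ 324 = 1 := by decide +kernel
  have h2 : ∀ q ∈ Nat.primeFactors 324, (4 : ZMod 1297) ^ (324 / q) ≠ 1 := by decide +kernel
  haveI : Fact (Nat.Prime 1297) := ⟨by norm_num⟩
  exact cuspSpanEvenAtTwo_of_check' 1297 324 4 (by norm_num) (by norm_num) h1 h2 (by norm_num) (by norm_num)

/-- `CuspSpanEvenAtTwo 1301`: `orderOf 4 = 650`, index `2`, Jacobi. [cite: Pollack2003, Conj. 6.3] -/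
theorem cuspSpanEvenAtTwo_jacobi_1301 : CuspSpanEvenAtTwo 1301 := by
  have h1 : (4 : ZMod 1301) ^ 650 = 1 := by decide +kernel
  have h2 : ∀ q ∈ Nat.primeFactors 650, (4 : ZMod 1301) ^ (650 / q) ≠ 1 := by decide +kernel
  haveI : Fact (Nat.Prime 1301) := ⟨by norm_num⟩
  exact cuspSpanEvenAtTwo_of_check' 1301 650 2 (by norm_num) (by norm_num) h1 h2 (by norm_num) (by norm_num)

/-- `CuspSpanEvenAtTwo 1303`: `orderOf 4 = 651`, `−1 ∉ ⟨4⟩`, index `1`, Jacobi. [cite: Pollack2003, Conj. 6.3] -/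
theorem cuspSpanEvenAtTwo_jacobi_1303 : CuspSpanEvenAtTwo 1303 := by
  have h1 : (4 : ZMod 1303) ^ 651 = 1 := by decide +kernel
  have h2 : ∀ q ∈ Nat.primeFactors 651, (4 : ZMod 1303) ^ (651 / q) ≠ 1 := by decide +kernel
  haveI : Fact (Nat.Prime 1303) := ⟨by norm_num⟩
  exact cuspSpanEvenAtTwo_of_check 1303 651 1 (by norm_num) (by norm_num) h1 h2 (Or.inl (by norm_num)) (by norm_num)
    (by norm_num)

/-- `CuspSpanEvenAtTwo 1307`: `orderOf 4 = 653`, `−1 ∉ ⟨4⟩`, index `1`, Jacobi. [cite: Pollack2003, Conj. 6.3] -/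
theorem cuspSpanEvenAtTwo_jacobi_1307 : CuspSpanEvenAtTwo 1307 := by
  have h1 : (4 : ZMod 1307) ^ 653 = 1 := by decide +kernel
  have h2 : ∀ q ∈ Nat.primeFactors 653, (4 : ZMod 1307) ^ (653 / q) ≠ 1 := by decide +kernel
  haveI : Fact (Nat.Prime 1307) := ⟨by norm_num⟩
  exact cuspSpanEvenAtTwo_of_check 1307 653 1 (by norm_num) (by norm_num) h1 h2 (Or.inl (by norm_num)) (by norm_num)
    (by norm_num)

/-- `CuspSpanEvenAtTwo 1319`: `orderOf 4 = 659`, `−1 ∉ ⟨4⟩`, index `1`, Jacobi. [cite: Pollack2003, Conj. 6.3] -/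
theorem cuspSpanEvenAtTwo_jacobi_1319 : CuspSpanEvenAtTwo 1319 := by
  have h1 : (4 : ZMod 1319) ^ 659 = 1 := by decide +kernel
  have h2 : ∀ q ∈ Nat.primeFactors 659, (4 : ZMod 1319) ^ (659 / q) ≠ 1 := by decide +kernel
  haveI : Fact (Nat.Prime 1319) := ⟨by norm_num⟩
  exact cuspSpanEvenAtTwo_of_check 1319 659 1 (by norm_num) (by norm_num) h1 h2 (Or.inl (by norm_num)) (by norm_num)
    (by norm_num)

/-- `CuspSpanEvenAtTwo 1327`: `orderOf 4 = 221`, `−1 ∉ ⟨4⟩`, index `3`, Jacobi. [cite: Pollack2003, Conj. 6.3] -/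
theorem cuspSpanEvenAtTwo_jacobi_1327 : CuspSpanEvenAtTwo 1327 := by
  have h1 : (4 : ZMod 1327) ^ 221 = 1 := by decide +kernel
  have h2 : ∀ q ∈ Nat.primeFactors 221, (4 : ZMod 1327) ^ (221 / q) ≠ 1 := by decide +kernel
  haveI : Fact (Nat.Prime 1327) := ⟨by norm_num⟩
  exact cuspSpanEvenAtTwo_of_check 1327 221 3 (by norm_num) (by norm_num) h1 h2 (Or.inl (by norm_num)) (by norm_num)
    (by norm_num)

/-- `CuspSpanEvenAtTwo 1361`: `orderOf 4 = 340`, index `4`, Jacobi. [cite: Pollack2003, Conj. 6.3] -/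
theorem cuspSpanEvenAtTwo_jacobi_1361 : CuspSpanEvenAtTwo 1361 := by
  have h1 : (4 : ZMod 1361) ^ 340 = 1 := by decide +kernel
  have h2 : ∀ q ∈ Nat.primeFactors 340, (4 : ZMod 1361) ^ (340 / q) ≠ 1 := by decide +kernel
  haveI : Fact (Nat.Prime 1361) := ⟨by norm_num⟩
  exact cuspSpanEvenAtTwo_of_check' 1361 340 4 (by norm_num) (by norm_num) h1 h2 (by norm_num) (by norm_num)

/-- `CuspSpanEvenAtTwo 1367`: `orderOf 4 = 683`, `−1 ∉ ⟨4⟩`, index `1`, Jacobi. [cite: Pollack2003, Conj. 6.3] -/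
theorem cuspSpanEvenAtTwo_jacobi_1367 : CuspSpanEvenAtTwo 1367 := by
  have h1 : (4 : ZMod 1367) ^ 683 = 1 := by decide +kernel
  have h2 : ∀ q ∈ Nat.primeFactors 683, (4 : ZMod 1367) ^ (683 / q) ≠ 1 := by decide +kernel
  haveI : Fact (Nat.Prime 1367) := ⟨by norm_num⟩
  exact cuspSpanEvenAtTwo_of_check 1367 683 1 (by norm_num) (by norm_num) h1 h2 (Or.inl (by norm_num)) (by norm_num)
    (by norm_num)

/-- `CuspSpanEvenAtTwo 1373`: `orderOf 4 = 686`, index `2`, Jacobi. [cite: Pollack2003, Conj. 6.3] -/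
theorem cuspSpanEvenAtTwo_jacobi_1373 : CuspSpanEvenAtTwo 1373 := by
  have h1 : (4 : ZMod 1373) ^ 686 = 1 := by decide +kernel
  have h2 : ∀ q ∈ Nat.primeFactors 686, (4 : ZMod 1373) ^ (686 / q) ≠ 1 := by decide +kernel
  haveI : Fact (Nat.Prime 1373) := ⟨by norm_num⟩
  exact cuspSpanEvenAtTwo_of_check' 1373 686 2 (by norm_num) (by norm_num) h1 h2 (by norm_num) (by norm_num)

/-- `CuspSpanEvenAtTwo 1381`: `orderOf 4 = 690`, index `2`, Jacobi. [cite: Pollack2003, Conj. 6.3] -/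
theorem cuspSpanEvenAtTwo_jacobi_1381 : CuspSpanEvenAtTwo 1381 := by
  have h1 : (4 : ZMod 1381) ^ 690 = 1 := by decide +kernel
  have h2 : ∀ q ∈ Nat.primeFactors 690, (4 : ZMod 1381) ^ (690 / q) ≠ 1 := by decide +kernel
  haveI : Fact (Nat.Prime 1381) := ⟨by norm_num⟩
  exact cuspSpanEvenAtTwo_of_check' 1381 690 2 (by norm_num) (by norm_num) h1 h2 (by norm_num) (by norm_num)

/-- `CuspSpanEvenAtTwo 1399`: `orderOf 4 = 233`, `−1 ∉ ⟨4⟩`, index `3`, Jacobi. [cite: Pollack2003, Conj. 6.3] -/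
theorem cuspSpanEvenAtTwo_jacobi_1399 : CuspSpanEvenAtTwo 1399 := by
  have h1 : (4 : ZMod 1399) ^ 233 = 1 := by decide +kernel
  have h2 : ∀ q ∈ Nat.primeFactors 233, (4 : ZMod 1399) ^ (233 / q) ≠ 1 := by decide +kernel
  haveI : Fact (Nat.Prime 1399) := ⟨by norm_num⟩
  exact cuspSpanEvenAtTwo_of_check 1399 233 3 (by norm_num) (by norm_num) h1 h2 (Or.inl (by norm_num)) (by norm_num)
    (by norm_num)

end Instances

end Summit.BirchSwinnertonDyer.BirchSwinnertonDyer.Theorems.SignedMuAtTwo
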